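import Mathlib.Tactic.Module
import Literature.Analysis.FluidPDE.StationaryEulerLaminatesHighDim
import HarnessLib

/-!
# Stub `stub_pressurelessLaminate` — pressureless laminates of finite order in `d = 3`
(crux `PointSink.PointFluxCone`, stmt-AnomalousDissipation-19033, line `Sketch`)

The laminate property of `𝒰_r = int 𝒦_r^{co}` (Choffrut–Székelyhidi 2014, Cor. 12, in the
laminate form of Prop. 15 (iii)) in dimension `3`, with the extra conclusion that EVERY splitting
certificate `(η, q)` of the splitting tree has `q = 0` ("pressureless" laminates).

The tree's `HighDim.laminate` (file `Literature/Analysis/FluidPDE/StationaryEulerLaminatesHighDim`)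
absorbs the stress gap `Σᵢ μᵢ fᵢ ⊗ fᵢ` by the stress splits `uLam` with certificates `(fᵢ, s²)`,
`q = s² ≠ 0`.  Here, in `d = 3`, the stress gap is absorbed instead by two layers of PAIRWISE
EXCHANGE splits in the directions `(0, fᵢ ⊗ fᵢ − fⱼ ⊗ fⱼ)`, certified by `(f_k, 0)` with
`k ∉ {i, j}` (`(fᵢ ⊗ fᵢ − fⱼ ⊗ fⱼ) f_k = 0`):
`μ_i P_i + μ_j P_j + μ_k P_k` is split along `P_i − P_j` into `(μ_i+μ_j) P_i + μ_k P_k` and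
`(μ_i+μ_j) P_j + μ_k P_k`, and each of these along `P_i − P_k` (resp. `P_j − P_k`) into the
targets `Aᵢ = (v, base + s² fᵢ ⊗ fᵢ)` of the tree, which are finally split by the tree's
(pressureless) velocity splits `vLam i` (Lemma 11, certificate `(ηᵢ, 0)`).

References: A. Choffrut, L. Székelyhidi Jr., *Weak solutions to the stationary incompressible
Euler equations*, SIAM J. Math. Anal. 46 (2014), Lemma 11, Cor. 12.
-/

noncomputable section

open scoped InnerProductSpace Topology
open Set Function Metric Filter
open Literature.Analysis.FluidPDE Literature.Analysis.FluidPDE.StationaryEuler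

set_option linter.dupNamespace false

namespace Summit.AnomalousDissipation.AnomalousDissipation.Theorems

/-! ## The exchange split of two targets `Aᵢ`, `A_k` (certificate `(fⱼ, 0)`) -/

/-- Barycentre of the exchange split `t δ_{Aᵢ}-part + (1-t) δ_{A_k}-part` (each part the tree's
velocity split `vLam`): `(v, base + t s² fᵢ⊗fᵢ + (1-t) s² f_k⊗f_k)`. -/
theorem pressurelessLaminate_exch_bary (D : HighDim.SplitData (Fin 3)) (i k j : Fin 3) (t : ℝ) :
    (Laminate.split t (D.f j) 0 (D.vLam i) (D.vLam k)).bary =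
      mkSt D.v (D.base + ((t * D.s2) • D.proj i + ((1 - t) * D.s2) • D.proj k)) := by
  -- adapted from Literature/Analysis/FluidPDE/StationaryEulerLaminatesHighDim (bary_uLam)
  rw [Laminate.bary_split, D.bary_vLam, D.bary_vLam, HighDim.SplitData.atomU,
    HighDim.SplitData.atomU, smul_mkSt, smul_mkSt, mkSt_add]
  congr 1
  · rw [← add_smul, add_sub_cancel, one_smul]
  · rw [smul_add, smul_add, smul_smul, smul_smul]
    module

/-- The barycentre of the exchange split lies in the convex set `𝒰_r`, `r > r'`. -/
theorem pressurelessLaminate_exch_bary_mem_U (D : HighDim.SplitData (Fin 3)) (i k j : Fin 3)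
    {t : ℝ} (ht0 : 0 ≤ t) (ht1 : t ≤ 1) {r : ℝ} (hr : D.r' < r) :
    (Laminate.split t (D.f j) 0 (D.vLam i) (D.vLam k)).bary ∈ HighDim.U r := by
  rw [Laminate.bary_split, D.bary_vLam, D.bary_vLam]
  exact HighDim.convex_U r (D.atomU_mem_U i hr) (D.atomU_mem_U k hr) ht0 (by linarith) (by ring)

/-- **Validity of the exchange split in `𝓛(𝒰_r)`**, `r > r' ≥ 0`: the direction
`(0, s² (f_k⊗f_k − fᵢ⊗fᵢ))` is certified by `(fⱼ, 0)` for `j ∉ {i, k}` (pressureless), the segment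
lies in the convex set `𝒰_r`, and the two children are the tree's valid velocity splits. -/
theorem pressurelessLaminate_exch_isValid (D : HighDim.SplitData (Fin 3)) {i k j : Fin 3}
    (hij : i ≠ j) (hkj : k ≠ j) {t : ℝ} (ht0 : 0 ≤ t) (ht1 : t ≤ 1) {r : ℝ} (hr : D.r' < r)
    (hr' : 0 ≤ D.r') : (Laminate.split t (D.f j) 0 (D.vLam i) (D.vLam k)).IsValid (HighDim.U r) := by
  -- adapted from Literature/Analysis/FluidPDE/StationaryEulerLaminatesHighDim (uLam_isValid)
  have hf : D.f j ≠ 0 := fun h => by simpa [h] using D.norm_f j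
  refine ⟨ht0, ht1, hf, ?_, ?_, ?_, D.vLam_isValid i hr hr', D.vLam_isValid k hr hr'⟩
  · rw [D.bary_vLam, D.bary_vLam, HighDim.SplitData.atomU, HighDim.SplitData.atomU, mkSt_sub,
      vel_mkSt, sub_self, inner_zero_left]
  · rw [D.bary_vLam, D.bary_vLam, HighDim.SplitData.atomU, HighDim.SplitData.atomU, mkSt_sub,
      str_mkSt, zero_smul, add_zero, add_sub_add_left_eq_sub, Matrix.sub_mulVec,
      Matrix.smul_mulVec, Matrix.smul_mulVec, D.proj_mulVec_f, D.proj_mulVec_f, if_neg hkj,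
      if_neg hij, smul_zero, sub_self]
  · rw [D.bary_vLam, D.bary_vLam]
    exact (HighDim.convex_U r).segment_subset (D.atomU_mem_U i hr) (D.atomU_mem_U k hr)

/-- The tree's velocity split `vLam i` is pressureless (its only certificate is `(ηᵢ, 0)`). -/
theorem pressurelessLaminate_vLam_rec (D : HighDim.SplitData (Fin 3)) (i : Fin 3) :
    Laminate.rec (motive := fun _ => Prop) (atom := fun _ => True)
      (split := fun _ _ q _ _ ihl ihr => q = 0 ∧ ihl ∧ ihr) (D.vLam i) :=
  ⟨rfl, trivial, trivial⟩

/-! ## The pressureless laminate of order `3` above a split datum of `Fin 3` -/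

/-- **The pressureless laminate.** For a split datum `D` over `Fin 3` and pairwise distinct indices
`i, j, k` (so that `s² = μᵢ + μⱼ + μ_k`), the splitting tree
`split (μᵢ/(μᵢ+μⱼ)) (f_k, 0) [split ((μᵢ+μⱼ)/s²) (fⱼ, 0) (vLam i) (vLam k)]
  [split ((μᵢ+μⱼ)/s²) (fᵢ, 0) (vLam j) (vLam k)]`
is valid in `𝓛(𝒰_r)` (`r > r' ≥ 0`), has barycentre `(v, base + μᵢ Pᵢ + μⱼ Pⱼ + μ_k P_k)`, atoms in
`𝒦_{r'}`, and all its certificates have `q = 0`. -/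
theorem pressurelessLaminate_exists (D : HighDim.SplitData (Fin 3)) {i j k : Fin 3} (hij : i ≠ j)
    (hik : i ≠ k) (hjk : j ≠ k) (hs : D.s2 = D.μ i + D.μ j + D.μ k) {r : ℝ} (hr : D.r' < r)
    (hr' : 0 ≤ D.r') :
    ∃ T : Laminate (Fin 3), T.IsValid (HighDim.U r) ∧
      T.bary = mkSt D.v (D.base + (D.μ i • D.proj i + D.μ j • D.proj j + D.μ k • D.proj k)) ∧
      T.AllAtoms (· ∈ K D.r') ∧
      Laminate.rec (motive := fun _ => Prop) (atom := fun _ => True)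
        (split := fun _ _ q _ _ ihl ihr => q = 0 ∧ ihl ∧ ihr) T := by
  have hμi := D.μ_pos i
  have hμj := D.μ_pos j
  have hμk := D.μ_pos k
  have hs2 : 0 < D.s2 := D.s2_pos
  have ha0 : 0 < D.μ i + D.μ j := by linarith
  have ht'0 : 0 ≤ (D.μ i + D.μ j) / D.s2 := by positivity
  have ht'1 : (D.μ i + D.μ j) / D.s2 ≤ 1 := div_le_one_of_le₀ (by linarith) hs2.le
  have h1 : (D.μ i + D.μ j) / D.s2 * D.s2 = D.μ i + D.μ j := div_mul_cancel₀ _ hs2.ne'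
  have h2 : (1 - (D.μ i + D.μ j) / D.s2) * D.s2 = D.μ k := by
    rw [sub_mul, one_mul, h1, hs]; ring
  have hA : (Laminate.split ((D.μ i + D.μ j) / D.s2) (D.f j) 0 (D.vLam i) (D.vLam k)).bary =
      mkSt D.v (D.base + ((D.μ i + D.μ j) • D.proj i + D.μ k • D.proj k)) := by
    rw [pressurelessLaminate_exch_bary, h1, h2]
  have hB : (Laminate.split ((D.μ i + D.μ j) / D.s2) (D.f i) 0 (D.vLam j) (D.vLam k)).bary =
      mkSt D.v (D.base + ((D.μ i + D.μ j) • D.proj j + D.μ k • D.proj k)) := by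
    rw [pressurelessLaminate_exch_bary, h1, h2]
  refine ⟨Laminate.split (D.μ i / (D.μ i + D.μ j)) (D.f k) 0
      (Laminate.split ((D.μ i + D.μ j) / D.s2) (D.f j) 0 (D.vLam i) (D.vLam k))
      (Laminate.split ((D.μ i + D.μ j) / D.s2) (D.f i) 0 (D.vLam j) (D.vLam k)), ?_, ?_,
    ⟨⟨D.vLam_allAtoms i, D.vLam_allAtoms k⟩, ⟨D.vLam_allAtoms j, D.vLam_allAtoms k⟩⟩,
    ⟨rfl, ⟨rfl, pressurelessLaminate_vLam_rec D i, pressurelessLaminate_vLam_rec D k⟩,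
      ⟨rfl, pressurelessLaminate_vLam_rec D j, pressurelessLaminate_vLam_rec D k⟩⟩⟩
  · -- validity of the top exchange split `(μᵢ+μⱼ) Pᵢ + μ_k P_k ⟶ (μᵢ+μⱼ) Pⱼ + μ_k P_k`
    have hf : D.f k ≠ 0 := fun h => by simpa [h] using D.norm_f k
    refine ⟨by positivity, div_le_one_of_le₀ (by linarith) ha0.le, hf, ?_, ?_, ?_,
      pressurelessLaminate_exch_isValid D hij hjk.symm ht'0 ht'1 hr hr',
      pressurelessLaminate_exch_isValid D hij.symm hik.symm ht'0 ht'1 hr hr'⟩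
    · rw [hA, hB, mkSt_sub, vel_mkSt, sub_self, inner_zero_left]
    · rw [hA, hB, mkSt_sub, str_mkSt, zero_smul, add_zero, add_sub_add_left_eq_sub,
        add_sub_add_right_eq_sub, Matrix.sub_mulVec, Matrix.smul_mulVec, Matrix.smul_mulVec,
        D.proj_mulVec_f, D.proj_mulVec_f, if_neg hjk, if_neg hik, smul_zero, sub_self]
    · exact (HighDim.convex_U r).segment_subset
        (pressurelessLaminate_exch_bary_mem_U D i k j ht'0 ht'1 hr)
        (pressurelessLaminate_exch_bary_mem_U D j k i ht'0 ht'1 hr)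
  · -- the barycentre
    have h3 : D.μ i / (D.μ i + D.μ j) * (D.μ i + D.μ j) = D.μ i := div_mul_cancel₀ _ ha0.ne'
    have h4 : (1 - D.μ i / (D.μ i + D.μ j)) * (D.μ i + D.μ j) = D.μ j := by
      rw [sub_mul, one_mul, h3]; ring
    rw [Laminate.bary_split, hA, hB, smul_mkSt, smul_mkSt, mkSt_add]
    congr 1
    · rw [← add_smul, add_sub_cancel, one_smul]
    · simp only [smul_add, smul_smul, h3, h4]
      module

/-! ## The stub -/

/-- **PL, binder form.** For `w ∈ 𝒰_r` (`d = 3`) and `ε > 0` there are `r' ∈ (r - ε, r)`, `r' ≥ 0`,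
and a pressureless laminate of finite order, valid in `𝓛(𝒰_r)`, with barycentre `w` and atoms in
`𝒦_{r'}`: the split datum of the tree's `HighDim.laminate` (eigen-decomposition of the positive
definite gap matrix at a level `r' < r` with `w ∈ 𝒰_{r'}`) fed into `pressurelessLaminate_exists`.
[cite: ChoffrutSzekelyhidi2014, Lemma 11, Cor. 12] -/
theorem pressurelessLaminate_main (r : ℝ) (w : State (Fin 3)) (ε : ℝ) (hw : w ∈ HighDim.U r)
    (hε : 0 < ε) :
    ∃ r' : ℝ, r - ε < r' ∧ r' < r ∧ 0 ≤ r' ∧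
      ∃ T : Laminate (Fin 3), T.IsValid (HighDim.U r) ∧ T.bary = w ∧ T.AllAtoms (· ∈ K r') ∧
        Laminate.rec (motive := fun _ => Prop) (atom := fun _ => True)
          (split := fun _ _ q _ _ ihl ihr => q = 0 ∧ ihl ∧ ihr) T := by
  -- adapted from Literature/Analysis/FluidPDE/StationaryEulerLaminatesHighDim (HighDim.laminate)
  have hd : 3 ≤ Fintype.card (Fin 3) := by simp
  have hr : 0 < r := lt_of_le_of_lt (sq_nonneg _) (HighDim.pos_of_mem_U hw)
  obtain ⟨r', h1, h2, h3, hw'⟩ := HighDim.exists_mem_U_of_lt hw hε hr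
  have hN : (gap r' w).IsHermitian := Matrix.isHermitian_iff_isSymm.2 (gap_isSymm hw'.1.1)
  have hPD : (gap r' w).PosDef := HighDim.posDef_gap hw'
  set D : HighDim.SplitData (Fin 3) :=
    { v := vel w, r' := r', f := hN.eigenvectorBasis, μ := hN.eigenvalues,
      ηs := fun i => HighDim.orthVec hd (vel w) (hN.eigenvectorBasis i),
      μ_pos := fun i => hPD.eigenvalues_pos i,
      norm_sq_add := by
        have ht := hN.trace_eq_sum_eigenvalues
        simp only [RCLike.ofReal_real_eq_id, id_eq] at ht
        rw [← ht, trace_gap hw'.1]; ring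
      ηs_ne := fun i => (HighDim.orthVec_spec hd _ _).1
      inner_v_ηs := fun i => (HighDim.orthVec_spec hd _ _).2.1
      inner_f_ηs := fun i => (HighDim.orthVec_spec hd _ _).2.2 }
  have hs : D.s2 = D.μ 0 + D.μ 1 + D.μ 2 := by
    rw [HighDim.SplitData.s2, Fin.sum_univ_three]
  obtain ⟨T, hT₁, hT₂, hT₃, hT₄⟩ := pressurelessLaminate_exists D (i := 0) (j := 1) (k := 2)
    (by decide) (by decide) (by decide) hs h2 h3.le
  refine ⟨r', h1, h2, h3.le, T, hT₁, ?_, hT₃, hT₄⟩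
  have hX : D.μ 0 • D.proj 0 + D.μ 1 • D.proj 1 + D.μ 2 • D.proj 2 = gap r' w := by
    rw [HighDim.eq_sum_eigenvalues_smul_vecMulVec hN, Fin.sum_univ_three]
    rfl
  rw [hT₂, hX]
  refine ext_vel_str (by rw [vel_mkSt]) ?_
  rw [str_mkSt, HighDim.SplitData.base, gap]
  change tensorSelf (vel w) - (r' / Fintype.card (Fin 3)) • (1 : Matrix (Fin 3) (Fin 3) ℝ) +
    (str w - tensorSelf (vel w) + (r' / Fintype.card (Fin 3)) • 1) = str w
  abel

/-- **PL (pressureless laminate property of `𝒰_r = int 𝒦_r^{co}`, `d = 3`).** Every `w ∈ 𝒰_r` is,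
for every `ε > 0`, the barycentre of a laminate of finite order valid in `𝓛(𝒰_r)`, supported in
`𝒦_{r'}` for some `r' ∈ (r − ε, r)`, `r' ≥ 0`, ALL of whose splitting certificates have `q = 0`
(the last conjunct, by structural recursion on the splitting tree).  Construction: the tree's
`HighDim.SplitData` (eigen-decomposition of the gap), the stress gap `Σ μᵢ fᵢ⊗fᵢ` absorbed by
pairwise exchange splits in the directions `(0, fᵢ⊗fᵢ − fⱼ⊗fⱼ)` certified by `(f_k, 0)`,
`k ∉ {i,j}`, each leaf `(v, base + s² fᵢ⊗fᵢ)` split by the tree's pressureless velocity split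
`vLam i` (certificate `(ηᵢ, 0)`). [cite: ChoffrutSzekelyhidi2014, Lemma 11, Cor. 12] -/
theorem stub_pressurelessLaminate : (∀ (r : ℝ) (w : State (Fin 3)) (ε : ℝ), w ∈ HighDim.U r → 0 < ε → ∃ r' : ℝ, r - ε < r' ∧ r' < r ∧ 0 ≤ r' ∧ ∃ T : Laminate (Fin 3), T.IsValid (HighDim.U r) ∧ T.bary = w ∧ T.AllAtoms (· ∈ K r') ∧ Laminate.rec (motive := fun _ => Prop) (atom := fun _ => True) (split := fun _ _ q _ _ ihl ihr => q = 0 ∧ ihl ∧ ihr) T) := by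
  intro r w ε hw hε
  exact pressurelessLaminate_main r w ε hw hε

end Summit.AnomalousDissipation.AnomalousDissipation.Theorems
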